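import Mathlib
import HarnessLib
import Literature.AlgebraicGeometry.Ramification.InertiaNormalSylow
import Summits.ResolutionOfSingularities.ResolutionOfSingularities.Theorems.WildQuotientsWildQuotientResolutionTameOrbitMove
import Summits.ResolutionOfSingularities.ResolutionOfSingularities.Theorems.WildQuotientsWildQuotientResolutionTameCoresPhaseZero

/-!
# Phase 0 in EVERY dimension for a LIST of separated tame families: iterated ORBIT tame moves
# (crux `WildQuotients.WildQuotientResolution`, stub `stub_phaseZeroHighDim`)

Crux stmt-ResolutionOfSingularities-15640 (`WildQuotientResolution`), registered stub `stub_phaseZeroHighDim`.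
The k-core engine ✓`standardise_tameCores` (p822635) with ORBIT centres: each step blows up the union `W = ⋃_{K ∈ S} Z_K`
of the inert loci of a conjugation-stable finite family `S` of tame subgroups with pairwise disjoint inert loci
(✓`tameOrbitCentre` p820560; the move in iterable form, `tameOrbitMove'`). Disjointness is required on the ORIGINAL
`X′` only — it persists to all later models because inert loci shrink (`Z_K(X₁) ⊆ π⁻¹ Z_K(X)`).

**Theorem** (`phaseZero_of_separatedTameFamilies`). Let `Ss` be a list of finite conjugation-stable families of
non-trivial subgroups of order prime to `p`, each family with pairwise disjoint inert loci on `X′`, such that every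
element `h ≠ 1` of order prime to `p` of every subgroup without a normal Sylow `p`-subgroup has `K ≤ ⟨h⟩` for some
member `K` of some family. Then the conclusion of `stub_phaseZeroHighDim` holds for the crux datum in every
dimension. This is the most general form of the standard-form route with the moves available in the tree; what
remains for the stub itself is to MAKE the families separated (orbit separation, evidence memo §5).

[OURS · crux stmt-ResolutionOfSingularities-15640 · helper toward `stub_phaseZeroHighDim` (an all-dimensional SLICE;
NOT a proof of the stub); counted 0; AI-level work, weaker than expert review.] [folklore]
-/

-- single-problem summit: the doubled namespace component `ResolutionOfSingularities` is forced
set_option linter.dupNamespace false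

noncomputable section

open CategoryTheory AlgebraicGeometry TopologicalSpace IsLocalRing
open Literature.AlgebraicGeometry.Resolution Literature.AlgebraicGeometry.Ramification
open Scheme.IdealSheafData
open Summit.ResolutionOfSingularities.ResolutionOfSingularities.Theorems.WildQuotientResolution
open Summit.ResolutionOfSingularities.ResolutionOfSingularities.Theorems.WildQuotientResolution.PointBlowupStalkData
open Summit.ResolutionOfSingularities.ResolutionOfSingularities.Theorems.WildQuotientResolution.InertLocusStalk

namespace Summit.ResolutionOfSingularities.ResolutionOfSingularities.Theorems.WildQuotientResolution.StandardForm

/-! ## The orbit tame move, iterable form -/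

/-- **The orbit tame move, iterable form** (cf. ✓`tameOrbitMove` p820631, whose affine invariant morphism `q` is
replaced by a `G`-stable affine cover and an invariant separated structure map; the lifted action is faithful and
the new structure map invariant, so the move can be repeated). Also exported: the centre ideal `𝓘_W` is invariant,
its subscheme regular, and at a point of `Z_K`, `K ∈ S`, its stalk is that of `𝓘_{Z_K}`. [folklore] -/
theorem tameOrbitMove' (p : ℕ) (hp : p.Prime) (k : Type) [Field k] [CharP k p]
    (X : Scheme.{0}) (s : X ⟶ Spec (.of k)) [IsSeparated s] [LocallyOfFiniteType s] [IsIntegral X]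
    (G : Type) [Group G] [Finite G] (ρ : G →* Aut X) (hfaith : Function.Injective ρ)
    (hreg : Scheme.IsRegular X) (hρ : ∀ g : G, (ρ g).hom ≫ s = s)
    (hcov : ∀ y : X, ∃ O : X.Opens, IsAffineOpen O ∧ y ∈ O ∧ ∀ g : G, (ρ g).hom ⁻¹ᵁ O = O)
    (S : Finset (Subgroup G)) (hS : ∀ (g : G), ∀ K ∈ S, K.map (MulAut.conj g).toMonoidHom ∈ S)
    (hS1 : ⊥ ∉ S) (hcop : ∀ K ∈ S, (Nat.card K).Coprime p)
    (hdisj : ∀ K ∈ S, ∀ K' ∈ S, K ≠ K' →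
      Disjoint {y : X | K ≤ inertiaSubgroup ρ y} {y : X | K' ≤ inertiaSubgroup ρ y}) :
    ∃ (hW : IsClosed (⋃ K ∈ S, {y : X | K ≤ inertiaSubgroup ρ y}))
      (Xs : Scheme.{0}) (π : Xs ⟶ X) (ρs : G →* Aut Xs), IsProper π ∧ IsBirational π ∧
      IsIntegral Xs ∧ Scheme.IsRegular Xs ∧ (∀ g : G, (ρs g).hom ≫ π = π ≫ (ρ g).hom) ∧
      IsBlowup π (vanishingIdeal ⟨⋃ K ∈ S, {y : X | K ≤ inertiaSubgroup ρ y}, hW⟩) ∧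
      (∀ x : Xs, inertiaSubgroup ρs x ≤ inertiaSubgroup ρ (π.base x)) ∧
      (∀ x : Xs, ∃ U : Xs.Opens, IsAffineOpen U ∧ x ∈ U ∧ ∀ g : G, (ρs g).hom ⁻¹ᵁ U = U) ∧
      Function.Injective ρs ∧ (∀ g : G, (ρs g).hom ≫ (π ≫ s) = π ≫ s) ∧
      (∀ g : G, (vanishingIdeal ⟨⋃ K ∈ S, {y : X | K ≤ inertiaSubgroup ρ y}, hW⟩).comap (ρ g).hom =
        vanishingIdeal ⟨⋃ K ∈ S, {y : X | K ≤ inertiaSubgroup ρ y}, hW⟩) ∧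
      Scheme.IsRegular (vanishingIdeal ⟨⋃ K ∈ S, {y : X | K ≤ inertiaSubgroup ρ y}, hW⟩).subscheme ∧
      (∀ K ∈ S, ∀ (hZK : IsClosed {y : X | K ≤ inertiaSubgroup ρ y}), ∀ x ∈ {y : X | K ≤ inertiaSubgroup ρ y},
        stalkIdeal (vanishingIdeal ⟨{y : X | K ≤ inertiaSubgroup ρ y}, hZK⟩) x =
          stalkIdeal (vanishingIdeal ⟨⋃ K ∈ S, {y : X | K ≤ inertiaSubgroup ρ y}, hW⟩) x) := by
  classical
  haveI : Fact p.Prime := ⟨hp⟩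
  haveI : IsLocallyNoetherian X := LocallyOfFiniteType.isLocallyNoetherian s
  haveI : X.IsSeparated := Scheme.isSeparated_of_isSeparated_over s
  have hZ : ∀ K : Subgroup G, IsClosed {y : X | K ≤ inertiaSubgroup ρ y} := fun K =>
    PointMoveNoNpcCurves.isClosed_setOf_le_inertia s ρ hρ K
  have hcharX : ∀ z : X, CharP (ResidueField (X.presheaf.stalk z)) p := fun z =>
    (((IsLocalRing.residue (X.presheaf.stalk z)).comp ((X.presheaf.germ ⊤ z trivial).hom.comp
      ((s.appTop).hom.comp (Scheme.ΓSpecIso (.of k)).inv.hom))).charP_iff_charP p).mp inferInstance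
  have hregK : ∀ K ∈ S, Scheme.IsRegular
      (vanishingIdeal ⟨{y : X | K ≤ inertiaSubgroup ρ y}, hZ K⟩).subscheme := fun K hK =>
    isRegular_subscheme_vanishingIdeal_inertLocus_of_coprime ρ K p (hZ K) (fun x _ => hreg x)
      (fun x _ => hcharX x) (hcop K hK)
  obtain ⟨hW, hcomap, hregW, hstalk⟩ := tameOrbitCentre ρ S hS hZ hdisj hregK
  set 𝒥 : X.IdealSheafData := vanishingIdeal ⟨⋃ K ∈ S, {y : X | K ≤ inertiaSubgroup ρ y}, hW⟩ with h𝒥def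
  -- non-zero: the generic point has trivial inertia and `⊥ ∉ S`
  have hJne : 𝒥 ≠ ⊥ := by
    intro h
    have hsupp : ((vanishingIdeal ⟨⋃ K ∈ S, {y : X | K ≤ inertiaSubgroup ρ y}, hW⟩).support : Set X) =
        Set.univ := by
      rw [← h𝒥def, h, Scheme.IdealSheafData.support_bot]
      rfl
    rw [Scheme.IdealSheafData.coe_support_vanishingIdeal] at hsupp
    have hη : genericPoint X ∈ ⋃ K ∈ S, {y : X | K ≤ inertiaSubgroup ρ y} := by
      have : (⋃ K ∈ S, {y : X | K ≤ inertiaSubgroup ρ y}) = Set.univ := hsupp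
      rw [this]; exact Set.mem_univ _
    obtain ⟨K, hK, hKη⟩ := Set.mem_iUnion₂.mp hη
    have hKη' : K ≤ inertiaSubgroup ρ (genericPoint X) := hKη
    rw [PhaseZeroDimOne.inertiaSubgroup_genericPoint_eq_bot s ρ hρ hfaith, le_bot_iff] at hKη'
    exact hS1 (hKη' ▸ hK)
  obtain ⟨Xs, π, hπ⟩ := exists_isBlowup X 𝒥
  let ρs : G →* Aut Xs := hπ.liftAction ρ hcomap
  have hequiv : ∀ g : G, (ρs g).hom ≫ π = π ≫ (ρ g).hom := hπ.liftAction_hom_comp ρ hcomap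
  haveI hXs : IsIntegral Xs := hπ.isIntegral hJne
  haveI hπp : IsProper π := hπ.isProper
  have hbir : IsBirational π := hπ.isBirational' hJne
  have hXsreg : Scheme.IsRegular Xs := hπ.isRegular_of_isRegular_subscheme hreg hregW
  have hρs : ∀ g : G, (ρs g).hom ≫ (π ≫ s) = π ≫ s := fun g => by
    rw [← Category.assoc, hequiv g, Category.assoc, hρ g]
  have hfaiths : Function.Injective ρs :=
    injective_of_equivariant_isBirational s ρ hfaith hρ π hbir ρs hequiv
  refine ⟨hW, Xs, π, ρs, hπp, hbir, hXs, hXsreg, hequiv, hπ, fun x => ?_, fun x => ?_, hfaiths, hρs, hcomap,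
    hregW, fun K hK hZK x hx => hstalk K hK x hx⟩
  · exact InertiaLe.stub_inertia_le ρs ρ π hequiv x
  · exact stableAffineCoverBlowup_of_cover ρ hcov hπ ρs hequiv x

/-! ## SNC of the orbit centre with a stable boundary -/

/-- **The orbit centre has simple normal crossings with a stable SNC boundary**: at a point of `W = ⋃ Z_K` the stalk
of `𝓘_W` is the stalk of `𝓘_{Z_K}` for the member through the point, to which ✓`hasSNCWith_inertLocus_of_hasSNC`
applies. [folklore] -/
theorem hasSNCWith_orbitCentre_of_hasSNC {X : Scheme.{0}} [IsLocallyNoetherian X] {G : Type} [Group G]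
    [Finite G] (σ : G →* Aut X) (p : ℕ) [Fact p.Prime]
    (hchar : ∀ x : X, CharP (ResidueField (X.presheaf.stalk x)) p) (S : Finset (Subgroup G))
    (hcop : ∀ K ∈ S, (Nat.card K).Coprime p) (hZ : ∀ K : Subgroup G, IsClosed {y : X | K ≤ inertiaSubgroup σ y})
    (hW : IsClosed (⋃ K ∈ S, {y : X | K ≤ inertiaSubgroup σ y}))
    (hstalk : ∀ K ∈ S, ∀ x ∈ {y : X | K ≤ inertiaSubgroup σ y},
      stalkIdeal (vanishingIdeal ⟨{y : X | K ≤ inertiaSubgroup σ y}, hZ K⟩) x =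
        stalkIdeal (vanishingIdeal ⟨⋃ K ∈ S, {y : X | K ≤ inertiaSubgroup σ y}, hW⟩) x)
    (E : List X.IdealSheafData) (hE : HasSNC E)
    (hEstab : ∀ D ∈ E, ∀ g : G, (σ g).hom.base ⁻¹' (D.support : Set X) = D.support) :
    HasSNCWith E (vanishingIdeal ⟨⋃ K ∈ S, {y : X | K ≤ inertiaSubgroup σ y}, hW⟩) := by
  intro x
  by_cases hxW : x ∈ (vanishingIdeal ⟨⋃ K ∈ S, {y : X | K ≤ inertiaSubgroup σ y}, hW⟩).support
  · have hxW' : x ∈ ⋃ K ∈ S, {y : X | K ≤ inertiaSubgroup σ y} := by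
      rw [← SetLike.mem_coe, Scheme.IdealSheafData.coe_support_vanishingIdeal] at hxW; exact hxW
    obtain ⟨K, hK, hxK⟩ := Set.mem_iUnion₂.mp hxW'
    obtain ⟨hregx, u, hu, hι, hC⟩ := hasSNCWith_inertLocus_of_hasSNC σ p K hchar (hcop K hK) (hZ K) E hE hEstab x
    refine ⟨hregx, u, hu, hι, fun _ => ?_⟩
    have hxZK : x ∈ (vanishingIdeal ⟨{y : X | K ≤ inertiaSubgroup σ y}, hZ K⟩).support := by
      rw [← SetLike.mem_coe, Scheme.IdealSheafData.coe_support_vanishingIdeal]; exact hxK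
    obtain ⟨S', hS'⟩ := hC hxZK
    exact ⟨S', by rw [← hstalk K hK x hxK, hS']⟩
  · obtain ⟨hregx, u, hu, hι, -⟩ := hE x
    exact ⟨hregx, u, hu, hι, fun h => absurd h hxW⟩

/-! ## The induction over the families -/

section Induction

variable (p : ℕ) [Fact p.Prime] (k : Type) [Field k] [CharP k p] {G : Type} [Group G] [Finite G]

/-- **p-standardisation along a list of separated tame families** (inductive engine, orbit centres). [folklore] -/
theorem standardise_tameFamilies :
    ∀ (Ss : List (Finset (Subgroup G))),
      (∀ S ∈ Ss, (∀ (g : G), ∀ K ∈ S, K.map (MulAut.conj g).toMonoidHom ∈ S) ∧ ⊥ ∉ S ∧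
        ∀ K ∈ S, (Nat.card K).Coprime p) →
    ∀ (X : Scheme.{0}) (s : X ⟶ Spec (.of k)) [IsSeparated s] [LocallyOfFiniteType s] [IsIntegral X]
      (ρ : G →* Aut X) (_ : Function.Injective ρ) (_ : Scheme.IsRegular X)
      (_ : ∀ g : G, (ρ g).hom ≫ s = s)
      (_ : ∀ y : X, ∃ O : X.Opens, IsAffineOpen O ∧ y ∈ O ∧ ∀ g : G, (ρ g).hom ⁻¹ᵁ O = O)
      (_ : ∀ S ∈ Ss, ∀ K ∈ S, ∀ K' ∈ S, K ≠ K' →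
        Disjoint {y : X | K ≤ inertiaSubgroup ρ y} {y : X | K' ≤ inertiaSubgroup ρ y})
      (E : List X.IdealSheafData) (_ : HasSNC E) (_ : ∀ D ∈ E, ∀ g : G, D.comap (ρ g).hom = D)
      (done : List (Subgroup G))
      (_ : ∀ M ∈ done, ∀ g : G, (orderOf g).Coprime p → M ≤ Subgroup.zpowers g →
        {y : X | Subgroup.zpowers g ≤ inertiaSubgroup ρ y} ⊆ ⋃ D ∈ E, (D.support : Set X)),
    ∃ (Xs : Scheme.{0}) (π : Xs ⟶ X) (ρs : G →* Aut Xs) (Es : List Xs.IdealSheafData),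
      IsProper π ∧ IsBirational π ∧ IsIntegral Xs ∧ Scheme.IsRegular Xs ∧
      (∀ g : G, (ρs g).hom ≫ π = π ≫ (ρ g).hom) ∧
      (∀ x : Xs, ∃ U : Xs.Opens, IsAffineOpen U ∧ x ∈ U ∧ ∀ g : G, (ρs g).hom ⁻¹ᵁ U = U) ∧
      HasSNC Es ∧ (∀ D ∈ Es, ∀ g : G, D.comap (ρs g).hom = D) ∧
      (∀ M ∈ done ++ (Ss.map Finset.toList).flatten, ∀ g : G, (orderOf g).Coprime p → M ≤ Subgroup.zpowers g →
        {y : Xs | Subgroup.zpowers g ≤ inertiaSubgroup ρs y} ⊆ ⋃ D ∈ Es, (D.support : Set Xs)) := by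
  intro Ss
  induction Ss with
  | nil =>
    intro _ X s _ _ _ ρ hfaith hreg hρ hcov _ E hE hEinv done hdone
    refine ⟨X, 𝟙 X, ρ, E, inferInstance, isBirational_id X, ‹_›, hreg, fun g => by simp, hcov, hE, hEinv, ?_⟩
    simpa using hdone
  | cons S Ss ih =>
    intro hSs X s _ _ _ ρ hfaith hreg hρ hcov hdisj E hE hEinv done hdone
    classical
    have hp : p.Prime := Fact.out
    obtain ⟨hS, hS1, hcop⟩ := hSs S List.mem_cons_self
    haveI : IsLocallyNoetherian X := LocallyOfFiniteType.isLocallyNoetherian s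
    have hchar : ∀ z : X, CharP (ResidueField (X.presheaf.stalk z)) p := fun z =>
      (((IsLocalRing.residue (X.presheaf.stalk z)).comp ((X.presheaf.germ ⊤ z trivial).hom.comp
        ((s.appTop).hom.comp (Scheme.ΓSpecIso (.of k)).inv.hom))).charP_iff_charP p).mp inferInstance
    have hZ : ∀ K : Subgroup G, IsClosed {y : X | K ≤ inertiaSubgroup ρ y} := fun K =>
      PointMoveNoNpcCurves.isClosed_setOf_le_inertia s ρ hρ K
    -- the orbit move along `W = ⋃_{K ∈ S} Z_K`
    obtain ⟨hW, X₁, π₁, ρ₁, hπ₁p, hbir₁, hX₁, hreg₁, hequiv₁, hbl₁, hle₁, hcov₁, hfaith₁, hρ₁, h𝒥inv, hregW,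
        hstalk⟩ :=
      tameOrbitMove' p hp k X s G ρ hfaith hreg hρ hcov S hS hS1 hcop (hdisj S List.mem_cons_self)
    haveI := hπ₁p; haveI := hX₁
    haveI : IsLocallyNoetherian X₁ := LocallyOfFiniteType.isLocallyNoetherian (π₁ ≫ s)
    set Wc : Closeds X := ⟨⋃ K ∈ S, {y : X | K ≤ inertiaSubgroup ρ y}, hW⟩ with hWcdef
    set 𝒥 : X.IdealSheafData := vanishingIdeal Wc with h𝒥def
    -- the new boundary
    set E₁ : List X₁.IdealSheafData := E.map (strictTransformIdeal π₁ 𝒥) ++ [𝒥.comap π₁] with hE₁def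
    have hEstab : ∀ D ∈ E, ∀ g : G, (ρ g).hom.base ⁻¹' (D.support : Set X) = D.support :=
      fun D hD g => preimage_support_of_comap_eq ρ g (hEinv D hD g)
    have hsncW : HasSNCWith E 𝒥 :=
      hasSNCWith_orbitCentre_of_hasSNC ρ p hchar S hcop hZ hW (fun K hK x hx => hstalk K hK (hZ K) x hx) E hE
        hEstab
    have hE₁ : HasSNC E₁ := hsncW.hasSNC_transform hbl₁
    have hE₁inv : ∀ D ∈ E₁, ∀ g : G, D.comap (ρ₁ g).hom = D := by
      intro D hD g
      rw [hE₁def, List.mem_append, List.mem_map, List.mem_singleton] at hD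
      rcases hD with ⟨D₀, hD₀, rfl⟩ | rfl
      · exact strictTransformIdeal_comap_of_invariant ρ₁ ρ π₁ hequiv₁ h𝒥inv (hEinv D₀ hD₀) g
      · exact comap_comap_of_invariant ρ₁ ρ π₁ hequiv₁ h𝒥inv g
    -- supports upstairs
    have hexc : ((𝒥.comap π₁).support : Set X₁) = π₁.base ⁻¹' (Wc : Set X) := by
      rw [support_comap]
      change π₁.base ⁻¹' ((𝒥.support : Closeds X) : Set X) = _
      rw [h𝒥def, Scheme.IdealSheafData.coe_support_vanishingIdeal]
    have hunion₁ : ∀ D ∈ E, π₁.base ⁻¹' (D.support : Set X) ⊆ ⋃ D' ∈ E₁, (D'.support : Set X₁) := by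
      intro D hD y hy
      rcases preimage_support_subset_strict_union_exceptional π₁ 𝒥 D hy with h | h
      · exact Set.mem_biUnion (show strictTransformIdeal π₁ 𝒥 D ∈ E₁ by
          rw [hE₁def]; exact List.mem_append_left _ (List.mem_map.mpr ⟨D, hD, rfl⟩)) h
      · exact Set.mem_biUnion (show 𝒥.comap π₁ ∈ E₁ by rw [hE₁def]; simp) h
    -- persistence for `done`, establishment for the members of `S`
    have hdone₁ : ∀ M ∈ done ++ S.toList, ∀ g : G, (orderOf g).Coprime p → M ≤ Subgroup.zpowers g →
        {y : X₁ | Subgroup.zpowers g ≤ inertiaSubgroup ρ₁ y} ⊆ ⋃ D ∈ E₁, (D.support : Set X₁) := by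
      intro M hM g hg hMg y hy
      have hy' : π₁.base y ∈ {y : X | Subgroup.zpowers g ≤ inertiaSubgroup ρ y} :=
        le_trans hy (hle₁ y)
      rw [List.mem_append, Finset.mem_toList] at hM
      rcases hM with hM | hM
      · obtain ⟨D, hD, hyD⟩ := Set.mem_iUnion₂.mp (hdone M hM g hg hMg hy')
        exact hunion₁ D hD (show y ∈ π₁.base ⁻¹' (D.support : Set X) from hyD)
      · refine Set.mem_biUnion (show 𝒥.comap π₁ ∈ E₁ by rw [hE₁def]; simp) ?_
        rw [SetLike.mem_coe, ← SetLike.mem_coe, hexc]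
        exact Set.mem_biUnion hM (le_trans hMg hy')
    -- disjointness persists upstairs
    have hdisj₁ : ∀ S' ∈ Ss, ∀ K ∈ S', ∀ K' ∈ S', K ≠ K' →
        Disjoint {y : X₁ | K ≤ inertiaSubgroup ρ₁ y} {y : X₁ | K' ≤ inertiaSubgroup ρ₁ y} := by
      intro S' hS' K hK K' hK' hne
      have h := hdisj S' (List.mem_cons_of_mem S hS') K hK K' hK' hne
      exact (h.preimage π₁.base).mono (fun y hy => le_trans hy (hle₁ y)) (fun y hy => le_trans hy (hle₁ y))
    -- recurse
    obtain ⟨X₂, π₂, ρ₂, E₂, hπ₂p, hbir₂, hX₂, hreg₂, hequiv₂, hcov₂, hE₂, hE₂inv, hdone₂⟩ :=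
      ih (fun S' hS' => hSs S' (List.mem_cons_of_mem S hS')) X₁ (π₁ ≫ s) ρ₁ hfaith₁ hreg₁ hρ₁ hcov₁ hdisj₁
        E₁ hE₁ hE₁inv (done ++ S.toList) hdone₁
    haveI := hπ₂p
    refine ⟨X₂, π₂ ≫ π₁, ρ₂, E₂, inferInstance, ComponentGluing.IsBirational.comp hbir₂ hbir₁, hX₂, hreg₂,
      fun g => ?_, hcov₂, hE₂, hE₂inv, ?_⟩
    · rw [← Category.assoc, hequiv₂ g, Category.assoc, hequiv₁ g, Category.assoc]
    · intro M hM
      refine hdone₂ M ?_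
      simpa [List.append_assoc] using hM

end Induction

/-! ## The theorem -/

/-- **Phase 0 in every dimension for a list of separated tame families** (crux stmt-ResolutionOfSingularities-15640,
a SLICE of `stub_phaseZeroHighDim`). See the module docstring. [folklore] -/
theorem phaseZero_of_separatedTameFamilies (p : ℕ) (hp : p.Prime) (k : Type) [Field k] [CharP k p]
    (X' X₁ : Scheme.{0}) (f : X₁ ⟶ Spec (.of k)) (q : X' ⟶ X₁) (G : Type) [Group G] [Finite G]
    (ρ : G →* Aut X') (hfaith : Function.Injective ρ)
    [IsSeparated f] [LocallyOfFiniteType f] [QuasiCompact f] [IsIntegral X']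
    (hreg : Scheme.IsRegular X') [IsFinite q] (hρ : ∀ g : G, (ρ g).hom ≫ q = q)
    (Ss : List (Finset (Subgroup G)))
    (hSs : ∀ S ∈ Ss, (∀ (g : G), ∀ K ∈ S, K.map (MulAut.conj g).toMonoidHom ∈ S) ∧ ⊥ ∉ S ∧
      ∀ K ∈ S, (Nat.card K).Coprime p)
    (hdisj : ∀ S ∈ Ss, ∀ K ∈ S, ∀ K' ∈ S, K ≠ K' →
      Disjoint {y : X' | K ≤ inertiaSubgroup ρ y} {y : X' | K' ≤ inertiaSubgroup ρ y})
    (hcore : ∀ H : Subgroup G, ¬ HasNormalSylow p H → ∀ h ∈ H, h ≠ 1 → (orderOf h).Coprime p →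
      ∃ S ∈ Ss, ∃ K ∈ S, K ≤ Subgroup.zpowers h) :
    ∃ (Xs : Scheme.{0}) (π : Xs ⟶ X') (ρs : G →* Aut Xs), IsProper π ∧ IsBirational π ∧
      IsIntegral Xs ∧ Scheme.IsRegular Xs ∧ (∀ g : G, (ρs g).hom ≫ π = π ≫ (ρ g).hom) ∧
      (∀ x : Xs, HasNormalSylow p (inertiaSubgroup ρs x)) ∧
      ∀ x : Xs, ∃ U : Xs.Opens, IsAffineOpen U ∧ x ∈ U ∧ ∀ g : G, (ρs g).hom ⁻¹ᵁ U = U := by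
  classical
  haveI : Fact p.Prime := ⟨hp⟩
  set s₀ : X' ⟶ Spec (.of k) := q ≫ f with hs₀
  obtain ⟨hρ₀, hcov₀⟩ := iterHypotheses_of_cruxData X' X₁ f q ρ hρ
  haveI : IsLocallyNoetherian X' := LocallyOfFiniteType.isLocallyNoetherian s₀
  obtain ⟨Xs, π, ρs, Es, hπp, hbir, hXs, hXsreg, hequiv, hcov, hEs, hEsinv, hest⟩ :=
    standardise_tameFamilies p k Ss hSs X' s₀ ρ hfaith hreg hρ₀ hcov₀ hdisj [] (hasSNC_nil_of_isRegular hreg)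
      (fun D hD => absurd hD (by simp)) [] (fun M hM => absurd hM (by simp))
  haveI := hπp; haveI := hXs
  have hρs : ∀ g : G, (ρs g).hom ≫ (π ≫ s₀) = π ≫ s₀ := fun g => by
    rw [← Category.assoc, hequiv g, Category.assoc, hρ₀ g]
  have hcharS : ∀ x : Xs, CharP (ResidueField (Xs.presheaf.stalk x)) p := fun x =>
    (((IsLocalRing.residue (Xs.presheaf.stalk x)).comp ((Xs.presheaf.germ ⊤ x trivial).hom.comp
      (((π ≫ s₀).appTop).hom.comp (Scheme.ΓSpecIso (.of k)).inv.hom))).charP_iff_charP p).mp inferInstance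
  have hZ' : ∀ K : Subgroup G, IsClosed {x : Xs | K ≤ inertiaSubgroup ρs x} := fun K =>
    PointMoveNoNpcCurves.isClosed_setOf_le_inertia (π ≫ s₀) ρs hρs K
  have hEstab : ∀ D ∈ Es, ∀ g : G, (ρs g).hom.base ⁻¹' (D.support : Set Xs) = D.support :=
    fun D hD g => preimage_support_of_comap_eq ρs g (hEsinv D hD g)
  refine ⟨Xs, π, ρs, hπp, hbir, hXs, hXsreg, hequiv, fun x => ?_, hcov⟩
  haveI := hcharS x
  haveI := hXsreg x
  let T := {D' : Xs.IdealSheafData // D' ∈ Es ∧ x ∈ D'.support}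
  haveI hTfin : Finite T :=
    (((List.finite_toSet Es).subset (fun D' (h : D' ∈ Es ∧ x ∈ D'.support) => h.1)).to_subtype :
      Finite {D' : Xs.IdealSheafData | D' ∈ Es ∧ x ∈ D'.support})
  haveI : Fintype T := Fintype.ofFinite T
  let n := Fintype.card T
  let e : T ≃ Fin n := Fintype.equivFin T
  obtain ⟨hregx, u, hu, ⟨ι, hιinj, hι⟩, -⟩ := hEs x
  have hrsop : IsRsopPart (u ∘ id) := isRsopPart_comp_of_rsop rfl u hu id Function.injective_id
  let z : Fin n → Xs.presheaf.stalk x := fun i => u (ι (e.symm i))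
  have hzT : ∀ D' : T, z (e D') = u (ι D') := fun D' => by simp only [z, Equiv.symm_apply_apply]
  have hvs : ∀ D' : T, stalkIdeal (vanishingIdeal D'.1.support) x = Ideal.span {u (ι D')} := fun D' => by
    rw [hEs.vanishingIdeal_support D'.2.1, hι D']
  by_contra hnpc
  have htame := hcore (inertiaSubgroup ρs x) hnpc
  refine hnpc (hasNormalSylow_inertia_of_standardForm ρs p x fun a τ hkey hτ =>
    ⟨n, z, fun i => hu ▸ Ideal.subset_span ⟨_, rfl⟩, fun i => hrsop.not_mem_sq _, fun g i => ?_,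
      fun g hg1 hg => ?_⟩)
  · exact apply_mem_span_of_stalkIdeal_eq_span ρs x a τ hkey hτ (e.symm i).1.support
      (fun g => hEstab _ (e.symm i).2.1 (g : G)) (hvs (e.symm i)) g
  · have hg1' : (g : G) ≠ 1 := fun h => hg1 (Subtype.ext h)
    obtain ⟨S, hS, K, hK, hKg⟩ := htame (g : G) g.2 hg1' (by rwa [Subgroup.orderOf_coe])
    have hKmem : K ∈ [] ++ (Ss.map Finset.toList).flatten := by
      rw [List.nil_append, List.mem_flatten]
      exact ⟨S.toList, List.mem_map.mpr ⟨S, hS, rfl⟩, Finset.mem_toList.mpr hK⟩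
    have hsub : {y : Xs | Subgroup.zpowers (g : G) ≤ inertiaSubgroup ρs y} ⊆ ⋃ D ∈ Es, (D.support : Set Xs) :=
      hest K hKmem (g : G) (by rwa [Subgroup.orderOf_coe]) hKg
    obtain ⟨D, hD, hxD, hle⟩ :=
      exists_mem_stalkIdeal_le_augIdeal_of_subset_iUnion ρs p x a τ hkey hτ g hg g.2 (hZ' _) Es hsub
    refine ⟨e ⟨D, hD, hxD⟩, ?_⟩
    rw [hzT]
    exact Ideal.mem_sup_left (hle ((hvs ⟨D, hD, hxD⟩) ▸ Ideal.mem_span_singleton_self _))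

end Summit.ResolutionOfSingularities.ResolutionOfSingularities.Theorems.WildQuotientResolution.StandardForm

end
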